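import Summits.CriticalPhenomena.SAWScalingLimit.Theorems.SAWDevelopingMapNoFoldBoundPeelConcat
import Summits.CriticalPhenomena.SAWScalingLimit.Theorems.SAWDevelopingMapNoFoldBoundPeelStrip
import Literature.Probability.RandomPlanarGeometry.HexSAWPathRigidity
import Literature.Probability.RandomPlanarGeometry.HexSAWBoundaryWinding

/-!
# Far phases of the peeled LP: windings from a local door to the sides of the strip

Helper file for the crux `NoFoldBound` (stmt-CriticalPhenomena-8296) of the route `SAWDevelopingMap`
(sub-problem `SAWScalingLimit` of `CriticalPhenomena`), programme FLAT / PEELED LP of the lead seats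
c9–c10 (`FLAT-LEAN-DESIGN.md` on the item, §L2(iii)), brick L2(iii-b). In the strip `S_{T,L}`
(`stripDom T L`, `PeelStrip.lean`) with a peeled set `K ∋ O`, a walk `γ` of `S_{T,L} ∖ K` from a local
door `{p, q}` (`p ∈ K`) to an exit half-edge `(y, w)` of the STRIP (`w ∉ S_{T,L}`: class `α`, `β` or
`ε ∪ ε̄` of Duminil-Copin–Smirnov) has a winding that does not depend on `T`, `L` or the walk: prefix a
fixed walk `pre : a → {p,q}` inside `K` (`a = {wOut, O}` the standard entrance); the concatenation is a
walk of the strip from `a` (`Peel.exists_concat`), its winding is `(π/3)·pturn` of its coordinate code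
(`HexMidEdgeSAW.winding_eq_pturn_code` with the standard chart `hvIso`), an `HV.IsMidWalk (stripV T L)`
whose turning the tree evaluates (`HV.pturn_of_isBetaDart / IsAlphaDart / IsEpsDart`,
`HexSAWBoundaryWinding.lean`), and the winding is additive at the door (`Peel.winding_concat`):

* `winding_eq_pturn_stripDom` — for a walk of `stripDom T L` from `a` to a strip exit: winding
  `= (π/3)·pturn(code)` and the code is an `IsMidWalk (stripV T L)` with final dart `(toHV y, toHV w)`;
* **`far_winding_beta`**: exit on `β` (top) ⟹ `W(γ) = −W(pre)`;
* **`far_winding_alpha`**: exit on `α` (bottom, column `k ≠ 0`) ⟹ `W(γ) = −π·sign k − W(pre)`;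
* **`far_winding_eps`**: exit on the left / right cut ⟹ `W(γ) = ± 2π/3 − W(pre)`.
-/

noncomputable section

open scoped Classical
open Literature.Probability.LatticeModels Literature.Probability.RandomPlanarGeometry.SAW
open Literature.Probability.RandomPlanarGeometry.SAW.HV

namespace Summit.CriticalPhenomena.SAWScalingLimit.Theorems.SAWDevelopingMapNoFoldBound.Peel

variable {T L : ℕ}

/-- The strip domain mapped to coordinates is `stripV T L`. -/
theorem map_hvIso_stripDom (T L : ℕ) :
    (stripDom T L).map hvIso.toEquiv.toEmbedding = HV.stripV T L := by
  ext v
  rw [Finset.mem_map]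
  constructor
  · rintro ⟨f, hf, rfl⟩
    exact mem_stripDom_iff.1 hf
  · intro hv
    exact ⟨ofHV v, mem_stripDom_iff.2 (by simpa using hv), by simp [hvIso]⟩

/-- The standard entrance vertex is outside the strip domain. -/
theorem ofHV_wOut_notMem (T L : ℕ) : ofHV wOut ∉ stripDom T L := by
  rw [mem_stripDom_iff, toHV_ofHV]; exact wOut_not_mem_stripV T L

/-- **Winding of a strip walk from the standard entrance = `(π/3)·pturn` of its code**, and the code
is a mid-edge walk of `stripV T L` in the sense of `HexSAWStrip` with final dart `(toHV y, toHV w)`. -/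
theorem winding_eq_pturn_stripDom {y w : HexVertex}
    (Γ : HexMidEdgeSAW (stripDom T L) s(ofHV wOut, ofHV hvOrigin) s(y, w)) (hne : Γ.verts ≠ [])
    (hyw : hexGraph.Adj y w) (hlast : Γ.verts.getLast hne = y) :
    Γ.winding = (Real.pi / 3) * (pturn (wOut :: (Γ.verts.map toHV ++ [toHV w])) : ℝ) ∧
      IsMidWalk (stripV T L) (wOut :: (Γ.verts.map toHV ++ [toHV w])) ∧
      finalDart (wOut :: (Γ.verts.map toHV ++ [toHV w])) = (toHV y, toHV w) := by
  have hu := ofHV_wOut_notMem T L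
  have hΦu : hvIso (ofHV wOut) = wOut := by simp [hvIso]
  have hΦw : hvIso (ofHV hvOrigin) = hvOrigin := by simp [hvIso]
  have haff : ∀ f, emb (pos (hvIso f)) = 3 * hexCenter f + 0 := fun f => emb_pos_toHV f
  have hW := Γ.winding_eq_pturn_code (e := w) rfl hu hΦu hΦw hyw haff three_ne_zero hne
    (Or.inl ⟨hlast, rfl⟩)
  have hM := Γ.isMidWalk_code hvIso rfl hu hΦu hΦw hyw hne (e := w) (Or.inl ⟨hlast, rfl⟩)
  rw [map_hvIso_stripDom] at hM
  have emap : Γ.verts.map hvIso = Γ.verts.map toHV := List.map_congr_left fun f _ => by simp [hvIso]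
  have ew : hvIso w = toHV w := by simp [hvIso]
  rw [emap, ew] at hW hM
  refine ⟨hW, hM, ?_⟩
  have hne' : Γ.verts.map toHV ≠ [] := by simpa using hne
  rw [finalDart_cons_append hne', List.getLast_map, hlast]

variable {K : Finset HexVertex} {p q y w : HexVertex}

/-- Common core: with the prefix `pre` through `K` glued in front, `W(pre) + W(γ) = (π/3)·pturn(code)` for an
`IsMidWalk (stripV T L)` code with final dart `(toHV y, toHV w)`. -/
theorem far_core (pre : HexMidEdgeSAW (stripDom T L) s(ofHV wOut, ofHV hvOrigin) s(p, q))
    (γ : HexMidEdgeSAW (stripDom T L \ K) s(p, q) s(y, w)) (hpre : pre.verts ≠ [])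
    (hpreK : ∀ v ∈ pre.verts, v ∈ K) (hKS : K ⊆ stripDom T L) (hO : ofHV hvOrigin ∈ K) (hqK : q ∉ K)
    (hq : q ∈ stripDom T L) (hpq : hexGraph.Adj p q) (hyw : hexGraph.Adj y w) (hw : w ∉ stripDom T L)
    (hγ : γ.verts ≠ []) :
    ∃ P : List HV, pre.winding + γ.winding = (Real.pi / 3) * (pturn P : ℝ) ∧ IsMidWalk (stripV T L) P ∧
      finalDart P = (toHV y, toHV w) := by
  -- the last vertex of `γ` is `y` (the far end `w` is outside), and it lies in `stripDom ∖ K`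
  have hlastD : γ.verts.getLast hγ ∈ stripDom T L \ K := γ.subset _ (List.getLast_mem hγ)
  have hyD : γ.verts.getLast hγ = y := by
    rcases γ.getLast_eq_or hγ with h | h
    · exact h
    · rw [h] at hlastD; exact absurd (Finset.mem_sdiff.1 hlastD).1 hw
  rw [hyD] at hlastD
  -- glue
  obtain ⟨Γ, hΓ⟩ := exists_concat (K := K) pre γ hpre hpreK hqK hq hpq
    (fun v hv => by
      rcases Sym2.mem_iff.1 hv with rfl | rfl
      · exact (Finset.mem_sdiff.1 hlastD).2
      · exact fun h => hw (hKS h))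
    (fun v hv hvS => by
      rcases Sym2.mem_iff.1 hv with rfl | rfl
      · exact absurd hvS (ofHV_wOut_notMem T L)
      · exact hO)
    hγ
  have hqpre : q ∉ pre.verts := fun h => hqK (hpreK q h)
  have hpD : p ∉ stripDom T L \ K := by
    intro h
    have hlast : pre.verts.getLast hpre = p := getLast_eq_of_notMem pre hpre hqpre
    have hm := List.getLast_mem hpre
    rw [hlast] at hm
    exact (Finset.mem_sdiff.1 h).2 (hpreK p hm)
  have hadd := winding_concat pre γ Γ hpre hqpre hpD hγ hΓ
  have hneΓ : Γ.verts ≠ [] := by rw [hΓ]; simp [hpre]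
  have hlastΓ : Γ.verts.getLast hneΓ = y := by
    have cg : ∀ (L₁ L₂ : List HexVertex) (h₁ : L₁ ≠ []) (h₂ : L₂ ≠ []), L₁ = L₂ →
        L₁.getLast h₁ = L₂.getLast h₂ := by rintro L₁ L₂ h₁ h₂ rfl; rfl
    rw [cg _ (pre.verts ++ γ.verts) hneΓ (by simp [hγ]) hΓ, List.getLast_append_of_ne_nil _ hγ, hyD]
  obtain ⟨hW, hM, hF⟩ := winding_eq_pturn_stripDom Γ hneΓ hyw hlastΓ
  exact ⟨_, by rw [← hadd, hW], hM, hF⟩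

/-- **Far phase on `β` (top side).** With the prefix `pre` through `K` glued in front, the walk does not
turn in total (`HV.pturn_of_isBetaDart`), so `W(γ) = −W(pre)`. -/
theorem far_winding_beta : ∀ {T L : ℕ} {K : Finset HexVertex} {p q y w : HexVertex} (pre : HexMidEdgeSAW (stripDom T L) s(ofHV HV.wOut, ofHV hvOrigin) s(p, q)) (γ : HexMidEdgeSAW (stripDom T L \ K) s(p, q) s(y, w)), pre.verts ≠ [] → (∀ v ∈ pre.verts, v ∈ K) → K ⊆ stripDom T L → ofHV hvOrigin ∈ K → q ∉ K → q ∈ stripDom T L → hexGraph.Adj p q → hexGraph.Adj y w → w ∉ stripDom T L → γ.verts ≠ [] → HV.IsBetaDart T (toHV y, toHV w) → γ.winding = -pre.winding := by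
  intro T L K p q y w pre γ hpre hpreK hKS hO hqK hq hpq hyw hw hγ hβ
  obtain ⟨P, hsum, hM, hF⟩ := far_core pre γ hpre hpreK hKS hO hqK hq hpq hyw hw hγ
  have h0 := pturn_of_isBetaDart hM (hF ▸ hβ)
  rw [h0] at hsum
  simp only [Int.cast_zero, mul_zero] at hsum
  linarith

/-- **Far phase on `α` (bottom side).** The total turning is `∓3` (`−π·sign k`, `k` the exit column,
`HV.pturn_of_isAlphaDart`), so `W(γ) = −π·sign k − W(pre)`. -/
theorem far_winding_alpha : ∀ {T L : ℕ} {K : Finset HexVertex} {p q y w : HexVertex} (pre : HexMidEdgeSAW (stripDom T L) s(ofHV HV.wOut, ofHV hvOrigin) s(p, q)) (γ : HexMidEdgeSAW (stripDom T L \ K) s(p, q) s(y, w)), pre.verts ≠ [] → (∀ v ∈ pre.verts, v ∈ K) → K ⊆ stripDom T L → ofHV hvOrigin ∈ K → q ∉ K → q ∈ stripDom T L → hexGraph.Adj p q → hexGraph.Adj y w → w ∉ stripDom T L → γ.verts ≠ [] → HV.IsAlphaDart (toHV y, toHV w) → (toHV y).1 ≠ 0 ∧ γ.winding = -(Real.pi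 * Int.sign (toHV y).1) - pre.winding := by
  intro T L K p q y w pre γ hpre hpreK hKS hO hqK hq hpq hyw hw hγ hα
  obtain ⟨P, hsum, hM, hF⟩ := far_core pre γ hpre hpreK hKS hO hqK hq hpq hyw hw hγ
  obtain ⟨hk, hP⟩ := pturn_of_isAlphaDart hM (hF ▸ hα)
  rw [hF] at hk hP
  refine ⟨hk, ?_⟩
  rw [hP] at hsum
  push_cast at hsum
  linarith

/-- **Far phase on `ε ∪ ε̄` (the oblique cuts).** The total turning is `+2` on the left cut and `−2` on
the right cut (`HV.pturn_of_isEpsDart`), so `W(γ) = 2π/3 − W(pre)` resp. `−2π/3 − W(pre)`. -/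
theorem far_winding_eps : ∀ {T L : ℕ} {K : Finset HexVertex} {p q y w : HexVertex} (pre : HexMidEdgeSAW (stripDom T L) s(ofHV HV.wOut, ofHV hvOrigin) s(p, q)) (γ : HexMidEdgeSAW (stripDom T L \ K) s(p, q) s(y, w)), pre.verts ≠ [] → (∀ v ∈ pre.verts, v ∈ K) → K ⊆ stripDom T L → ofHV hvOrigin ∈ K → q ∉ K → q ∈ stripDom T L → hexGraph.Adj p q → hexGraph.Adj y w → w ∉ stripDom T L → γ.verts ≠ [] → HV.IsEpsDart L (toHV y, toHV w) → ((toHV w).1 = (toHV y).1 ∧ γ.winding = 2 * Real.pi / 3 - pre.winding) ∨ ((toHV w).1 = (toHV y).1 + 1 ∧ γ.winding = -(2 * Real.pi / 3) - pre.winding) := by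
  intro T L K p q y w pre γ hpre hpreK hKS hO hqK hq hpq hyw hw hγ hε
  obtain ⟨P, hsum, hM, hF⟩ := far_core pre γ hpre hpreK hKS hO hqK hq hpq hyw hw hγ
  rcases pturn_of_isEpsDart hM (hF ▸ hε) with ⟨h1, hP⟩ | ⟨h1, hP⟩
  · left
    rw [hF] at h1; rw [hP] at hsum
    refine ⟨h1, ?_⟩
    push_cast at hsum
    linarith
  · right
    rw [hF] at h1; rw [hP] at hsum
    refine ⟨h1, ?_⟩
    push_cast at hsum
    linarith

end Summit.CriticalPhenomena.SAWScalingLimit.Theorems.SAWDevelopingMapNoFoldBound.Peel
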